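import Summits.NavierStokesRegularity.OSWSelfSimilar.SheetRSolutionOperator
import Mathlib.Analysis.SpecificLimits.Normed
import HarnessLib

/-!
# SHEET-ℝ frame, MODEL ASSEMBLY layer 3e: from the solution operator of the coercive part `B_λ` to that of `B_λ − P`
# (the Neumann / right-inverse glue behind (C3)), abstract and for the sheet

HONEST FRAMING (cell ns-blowup GROUP B / zone Z3, case Z3-SR-CERT; 1-D MODEL certificate frame (viscous gCLM/OSW sheet on the line); not
Euler/NS; «violates: none — MODEL»). Nothing here asserts that a profile exists; every smallness / invertibility input is a HYPOTHESIS (the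
certificate's (C2)–(C3) numerics).

The certificate's linear part is `DG(Ω̄) = B_λ − P` (`CertificateViscousSheetR`, FRAME): `B_λ` coercive (its weak solution operator
`S : L²_w →L E` is `SheetRSolutionOperator.exists_solutionOperator`), `P : E → L²_w` bounded (nonlocal, finite-rank-approximated).  The row
`CertificateViscousSheetRFixedPoint.existsUnique_fixedPoint_of_row_w` consumes the solution operator of `DG(Ω̄)` itself.  This file is the glue:

* §1 (abstract; `F` normed, `Φ` a vector space, `W` normed, `E : F → Φ → ℝ` and `P : W → Φ → ℝ` bilinear, `S : W →L F` with `E(S g, ·) = P g`):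
  for a bounded `Pop : F →L W` and ANY bounded right inverse `M` of `1 − S∘Pop` (`M x − S (Pop (M x)) = x`; Woodbury/capacitance or Neumann),
  `T := M ∘ S` solves **`E(T g, φ) = P (g + Pop (T g)) φ`** — the weak form of `(A − Pop) T g = g` when `E` is the form of `A` and `P` the
  pivot pairing — with `‖T g‖ ≤ ‖M‖‖S g‖` (`solutionOperator_sub_of_rightInverse`); the NEUMANN case `‖S∘Pop‖ < 1` supplies
  `M = Σ (S∘Pop)ⁿ` with `‖M‖ ≤ (1 − ‖S∘Pop‖)⁻¹` (`exists_solutionOperator_sub_of_norm_lt_one`).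
* §2 (sheet): with `S` from `exists_solutionOperator` (‖S‖ ≤ 2/κ) and `Pop : Esp L hL →L W L` with `(2/κ)‖Pop‖ ≤ θ < 1`: a bounded linear
  `T : W L →L[ℝ] Esp L hL` with `linForm(prim (der (T g)), der (T g); v, v₁) = ∫ w (g + Pop (T g)) v` for every compactly supported test and
  `‖T g‖ ≤ (2/κ)(1 − θ)⁻¹‖g‖` (`exists_solutionOperator_sub`).  (The certificate's (C3) obtains its `M` by Woodbury on `B_λ − Π_N P` plus a
  Neumann remainder `ε_N`; §1's right-inverse form covers that route, §2 the plain Neumann one.)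
Pure operator algebra; no definition, no named fact. WHAT THIS IS NOT: not NS; not the capacitance-matrix arithmetic; no number moves.
-/

noncomputable section

namespace Summit.NavierStokesRegularity.OSWSelfSimilar
namespace SheetRSolutionOperatorPerturbation

open _root_.MeasureTheory _root_.Set _root_.Filter _root_.Real SheetRWeakProfilePV SheetRWeakToStrong SheetREnergyClass SheetRWeightedMeasure
  SheetRLinearisedTests SheetREnergySpace SheetRTestSpace SheetRLinearisedFormBounds SheetRSolutionOperator
open scoped Topology ENNReal

/-! ### §1 Abstract glue -/

section Abstract

variable {F : Type*} [NormedAddCommGroup F] [NormedSpace ℝ F] {Φ : Type*} [AddCommGroup Φ] [Module ℝ Φ]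
  {W : Type*} [NormedAddCommGroup W] [NormedSpace ℝ W]

/-- **Right-inverse glue.** If `E(S g, ·) = P g` for all `g`, `Pop : F →L W` is bounded and `M : F →L F` satisfies `M x − S (Pop (M x)) = x`
(a right inverse of `1 − S∘Pop`), then `T := M ∘ S` solves `E(T g, φ) = P (g + Pop (T g)) φ` and `‖T g‖ ≤ ‖M‖·‖S g‖`. [folklore] -/
theorem solutionOperator_sub_of_rightInverse (E : F →ₗ[ℝ] Φ →ₗ[ℝ] ℝ) (P : W →ₗ[ℝ] Φ →ₗ[ℝ] ℝ) (S : W →L[ℝ] F)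
    (hS : ∀ g φ, E (S g) φ = P g φ) (Pop : F →L[ℝ] W) (M : F →L[ℝ] F) (hM : ∀ x, M x - S (Pop (M x)) = x) :
    (∀ g φ, E ((M.comp S) g) φ = P (g + Pop ((M.comp S) g)) φ) ∧ ∀ g, ‖(M.comp S) g‖ ≤ ‖M‖ * ‖S g‖ := by
  refine ⟨fun g φ => ?_, fun g => M.le_opNorm (S g)⟩
  have h1 : (M.comp S) g = S (g + Pop ((M.comp S) g)) := by
    have h := hM (S g)
    rw [ContinuousLinearMap.comp_apply, map_add]
    rw [sub_eq_iff_eq_add] at h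
    rw [← h]
  nth_rewrite 1 [h1]
  exact hS _ φ

/-- **Neumann glue.** If moreover `‖S ∘ Pop‖ < 1` (and `F` is complete), the Neumann series `M = Σₙ (S∘Pop)ⁿ` is a two-sided inverse of
`1 − S∘Pop` with `‖M‖ ≤ (1 − ‖S∘Pop‖)⁻¹`, so there is `T : W →L F` with `E(T g, φ) = P (g + Pop (T g)) φ` and
`‖T g‖ ≤ (1 − ‖S∘Pop‖)⁻¹·‖S g‖`. [folklore] -/
theorem exists_solutionOperator_sub_of_norm_lt_one [CompleteSpace F] (E : F →ₗ[ℝ] Φ →ₗ[ℝ] ℝ) (P : W →ₗ[ℝ] Φ →ₗ[ℝ] ℝ)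
    (S : W →L[ℝ] F) (hS : ∀ g φ, E (S g) φ = P g φ) (Pop : F →L[ℝ] W) (hlt : ‖S.comp Pop‖ < 1) :
    ∃ T : W →L[ℝ] F, (∀ g φ, E (T g) φ = P (g + Pop (T g)) φ) ∧ ∀ g, ‖T g‖ ≤ (1 - ‖S.comp Pop‖)⁻¹ * ‖S g‖ := by
  set U : (F →L[ℝ] F)ˣ := Units.oneSub (S.comp Pop) hlt with hU
  set M : F →L[ℝ] F := (↑U⁻¹ : F →L[ℝ] F) with hMdef
  -- `(1 − S∘Pop) ∘ M = 1`
  have hright : ((1 : F →L[ℝ] F) - S.comp Pop) * M = 1 := by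
    have h : (U : F →L[ℝ] F) * M = 1 := by rw [hMdef]; exact U.mul_inv
    have hval : (U : F →L[ℝ] F) = 1 - S.comp Pop := rfl
    rwa [hval] at h
  have hM : ∀ x, M x - S (Pop (M x)) = x := by
    intro x
    have h := congrArg (fun A : F →L[ℝ] F => A x) hright
    simpa using h
  -- `‖M‖ ≤ (1 − ‖S∘Pop‖)⁻¹`
  have hMnorm : ‖M‖ ≤ (1 - ‖S.comp Pop‖)⁻¹ := by
    have hinv : M = ∑' n : ℕ, (S.comp Pop) ^ n := by rw [hMdef, hU]; rfl
    rw [hinv]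
    have h := tsum_geometric_le_of_norm_lt_one (S.comp Pop) hlt
    have h1 : ‖(1 : F →L[ℝ] F)‖ ≤ 1 := ContinuousLinearMap.norm_id_le
    linarith
  obtain ⟨hsol, hbd⟩ := solutionOperator_sub_of_rightInverse E P S hS Pop M hM
  refine ⟨M.comp S, hsol, fun g => (hbd g).trans ?_⟩
  exact mul_le_mul_of_nonneg_right hMnorm (norm_nonneg _)

end Abstract

/-! ### §2 The sheet reading: the solution operator of `B_λ − Pop` on the concrete spaces -/

/-- **Solution operator of the perturbed sheet operator (Neumann case).**  Under the hypotheses of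
`SheetRSolutionOperator.exists_solutionOperator` (`κ`-coercivity of `linForm L d V` on compactly supported tests) and for a bounded
`Pop : Esp L hL →L[ℝ] W L` with `(2/κ)‖Pop‖ ≤ θ < 1`: there is a bounded LINEAR `T : W L →L[ℝ] Esp L hL` such that for every `g ∈ L²_w` the
profile of `T g` solves the weak equation of `B u − Pop u = g`, i.e. `linForm(prim (der (T g)), der (T g); v, v₁) = ∫ w (g + Pop (T g)) v` for
every compactly supported test, and `‖T g‖ ≤ (2/κ)(1 − θ)⁻¹‖g‖`. [folklore] -/
theorem exists_solutionOperator_sub {L D₀ D₁ V₀ : ℝ} {d V : ℝ → ℝ} (hL : 0 < L) (hdm : AEStronglyMeasurable d volume)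
    (hVm : AEStronglyMeasurable V volume) (hD₁ : 0 ≤ D₁) (hd : ∀ ξ, |d ξ| ≤ D₀ + D₁ * |ξ|) (hV : ∀ ξ, |V ξ| ≤ V₀) {κ : ℝ} (hκ : 0 < κ)
    (hcoer : ∀ v v₁ : ℝ → ℝ, IsCompactTest v v₁ →
      κ * ((∫ ξ, (L ^ 2 + ξ ^ 2) * v₁ ξ ^ 2) + 1 / 4 * ∫ ξ, (L ^ 2 + ξ ^ 2) * v ξ ^ 2) ≤ linForm L d V v v₁ v v₁)
    (Pop : Esp L hL →L[ℝ] W L) {θ : ℝ} (hθ : θ < 1) (hPop : 2 / κ * ‖Pop‖ ≤ θ) :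
    ∃ T : W L →L[ℝ] Esp L hL,
      (∀ (g : W L) (v v₁ : ℝ → ℝ), IsCompactTest v v₁ →
        linForm L d V (prim (der (T g))) (der (T g)) v v₁ =
          ∫ y, (L ^ 2 + y ^ 2) * (((g + Pop (T g) : W L) : ℝ → ℝ) y * v y)) ∧
      ∀ g : W L, ‖T g‖ ≤ 2 / κ * (1 - θ)⁻¹ * ‖g‖ := by
  haveI : CompleteSpace (Esp L hL) := completeSpace_Esp hL
  -- the coercive part's solution operator, as a solution of the bilinear identity `Eform (S g) = Pdata g`
  have hE : ∀ vp : testSpace, ∃ K : ℝ, ∀ p : Esp L hL, |Eform hL hdm hVm hD₁ hd hV p vp| ≤ K * ‖p‖ := fun vp =>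
    ⟨_, fun p => by rw [Eform_apply]; exact (abs_linForm_profile_le hL hdm hVm hD₁ hd hV vp p).2⟩
  have hcoer' : ∀ vp : testSpace, κ * ‖jmap hL vp‖ ^ 2 ≤ Eform hL hdm hVm hD₁ hd hV (jmap hL vp) vp := by
    intro vp
    rw [Eform_jmap, sq_norm_jmap]
    have h := hcoer vp.1.1 vp.1.2 vp.2
    linarith
  obtain ⟨S, hS, hSn⟩ := Literature.Analysis.OperatorTheory.exists_solutionOperator_of_coercive (F := Esp L hL) (jmap hL)
    (fun vp => ‖jmap hL vp‖) (fun _ => norm_nonneg _) (C := 1) zero_le_one (fun vp => by rw [one_mul]) (Eform hL hdm hVm hD₁ hd hV)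
    hE hκ hcoer' (Pdata hL) (CP := 2) (by norm_num) (fun g vp => abs_Pdata_le hL g vp)
  -- `‖S‖ ≤ 2/κ`, hence `‖S ∘ Pop‖ ≤ θ < 1`
  have hSnorm : ‖S‖ ≤ 2 / κ := by
    refine ContinuousLinearMap.opNorm_le_bound _ (by positivity) fun g => ?_
    calc ‖S g‖ ≤ 2 * (1 / κ) * ‖g‖ := hSn g
      _ = 2 / κ * ‖g‖ := by ring
  have hcomp : ‖S.comp Pop‖ ≤ θ := by
    calc ‖S.comp Pop‖ ≤ ‖S‖ * ‖Pop‖ := ContinuousLinearMap.opNorm_comp_le _ _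
      _ ≤ 2 / κ * ‖Pop‖ := mul_le_mul_of_nonneg_right hSnorm (norm_nonneg Pop)
      _ ≤ θ := hPop
  have hlt : ‖S.comp Pop‖ < 1 := hcomp.trans_lt hθ
  obtain ⟨T, hT, hTn⟩ := exists_solutionOperator_sub_of_norm_lt_one (Eform hL hdm hVm hD₁ hd hV) (Pdata hL) S hS Pop hlt
  refine ⟨T, fun g v v₁ hv => ?_, fun g => ?_⟩
  · have h := hT g ⟨(v, v₁), hv⟩
    rw [Eform_apply, Pdata_apply] at h
    exact h
  · have h1θ : 0 < 1 - θ := by linarith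
    have hθ0 : 0 ≤ θ := le_trans (by positivity) hPop
    calc ‖T g‖ ≤ (1 - ‖S.comp Pop‖)⁻¹ * ‖S g‖ := hTn g
      _ ≤ (1 - θ)⁻¹ * (2 / κ * ‖g‖) := by
          have hA : (1 - ‖S.comp Pop‖)⁻¹ ≤ (1 - θ)⁻¹ := by
            rw [inv_le_inv₀ (by linarith [norm_nonneg (S.comp Pop)]) h1θ]; linarith
          have hB : ‖S g‖ ≤ 2 / κ * ‖g‖ := by
            calc ‖S g‖ ≤ 2 * (1 / κ) * ‖g‖ := hSn g
              _ = 2 / κ * ‖g‖ := by ring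
          exact mul_le_mul hA hB (norm_nonneg _) (inv_nonneg.2 h1θ.le)
      _ = 2 / κ * (1 - θ)⁻¹ * ‖g‖ := by ring

end SheetRSolutionOperatorPerturbation
end Summit.NavierStokesRegularity.OSWSelfSimilar

end
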